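import Summits.MatrixMultiplication.MatrixMultiplication.Theorems.ObstructionDescentSchurWeylObligation

set_option linter.dupNamespace false
set_option autoImplicit false

/-!
# Obstruction descent — `P_O` at ONE FORMAT per `n` (decomp-mm · lens 3 · gen 29, def-free)

`route-MatrixMultiplication-ObstructionDescent`, crux `NoOccurrenceObstruction` (`P_O`, stmt 29040); NODE-g29 §4.  By
`noOccurrenceObstruction_iff_semigroup_containment` the crux reads `∀ τ > 2, eventually S(⟨n,n,n⟩) ⊆ S(⟨m⟩) for EVERY format
m ≥ n², n^τ`.  The unit-tensor semigroups increase with the format — `S(⟨m⟩) ⊆ S(⟨m'⟩)` for `m ≤ m'`, because `⟨m⟩` is a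
restriction of `⟨m'⟩` (`unitTensor_eq_actTensor_of_injective`) and occurrence passes from a restriction to the tensor — so the
format quantifier collapses to the SMALLEST admissible format `m₀(n,τ) = max(n², ⌈n^τ⌉)`:

  `P_O  ⟺  ∀ τ > 2, ∃ n₀, ∀ n ≥ n₀,  S(⟨n,n,n⟩) ⊆ S(⟨max(n², ⌈n^τ⌉)⟩)`   (`noOccurrenceObstruction_iff_minFormat_semigroup`),

a one-parameter family of semigroup containments (and the same collapse in the calculus language,
`noOccurrenceObstruction_iff_minFormat`).
No proposition is defined; no `def`; sorry-free; standard axioms.  Nothing here proves `ω = 2` or closes an item.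
[cite: BurgisserIkenmeyer2011, §3.1 (S(w) grows under restriction w ≤ w'), §5]
-/

noncomputable section

open scoped BigOperators

namespace Summit.MatrixMultiplication.MatrixMultiplication.Theorems.ObstructionCalculus

open Literature.Computability.AlgebraicComplexity (actTensor actTensor_apply kroneckerPow isotypicSum₁ isotypicSum₂ isotypicSum₃
  matMulTensor unitTensor unitTensor_apply isotypicSum₁₂₃_kroneckerPow_ne_zero_of_actTensor)
open Summit.MatrixMultiplication.MatrixMultiplication.Theses.ObstructionDescent (NoOccurrenceObstruction)
open Summit.MatrixMultiplication.MatrixMultiplication.Theorems.ObstructionDescentInformationAxis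
  (noOccurrenceObstruction_iff)

/-- **`⟨m⟩` is a restriction of `⟨m'⟩`** along any injection `e : [m] ↪ [m']`: `⟨m⟩ = (E,E,E)·⟨m'⟩` with `E_{i a} = [e i = a]`.
[cite: BurgisserIkenmeyer2011, §3.1] -/
theorem unitTensor_eq_actTensor_of_injective {m m' : ℕ} (e : Fin m → Fin m') (he : Function.Injective e) :
    unitTensor ℂ m = actTensor (fun (i : Fin m) (a : Fin m') => if e i = a then (1 : ℂ) else 0)
      (fun (i : Fin m) (a : Fin m') => if e i = a then (1 : ℂ) else 0)
      (fun (i : Fin m) (a : Fin m') => if e i = a then (1 : ℂ) else 0) (unitTensor ℂ m') := by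
  classical
  funext i j l
  rw [actTensor_apply]
  simp only [unitTensor_apply, ite_mul, one_mul, zero_mul]
  by_cases hij : i = j <;> by_cases hjl : j = l <;> simp [hij, hjl, he.eq_iff]

/-- **The unit-tensor semigroups increase with the format**: `S(⟨m⟩) ⊆ S(⟨m'⟩)` for `m ≤ m'` — a triple occurring in `⟨m⟩^{⊗d}`
occurs in `⟨m'⟩^{⊗d}` (occurrence passes from the restriction `⟨m⟩ = (E,E,E)·⟨m'⟩` to `⟨m'⟩`).
[cite: BurgisserIkenmeyer2011, §3.1] -/
theorem isotypicSum_kroneckerPow_unitTensor_mono {m m' : ℕ} (hmm' : m ≤ m') {d : ℕ} (lam : Fin 3 → Nat.Partition d)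
    (h : isotypicSum₁ (lam 0) (isotypicSum₂ (lam 1) (isotypicSum₃ (lam 2) (kroneckerPow (unitTensor ℂ m) d))) ≠ 0) :
    isotypicSum₁ (lam 0) (isotypicSum₂ (lam 1) (isotypicSum₃ (lam 2) (kroneckerPow (unitTensor ℂ m') d))) ≠ 0 := by
  rw [unitTensor_eq_actTensor_of_injective (Fin.castLE hmm') (Fin.castLE_injective hmm')] at h
  exact isotypicSum₁₂₃_kroneckerPow_ne_zero_of_actTensor h

/-- **`P_O` at one format per `n` (semigroup language).**  `NoOccurrenceObstruction ⟺ ∀ τ > 2, ∃ n₀, ∀ n ≥ n₀, S(⟨n,n,n⟩) ⊆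
S(⟨m₀⟩)` for the single format `m₀ = max(n², ⌈n^τ⌉)`: the containment at `m₀` gives it at every larger format by
`isotypicSum_kroneckerPow_unitTensor_mono`. [cite: BurgisserIkenmeyer2011, §3.1, §5] -/
theorem noOccurrenceObstruction_iff_minFormat_semigroup :
    NoOccurrenceObstruction ↔
      ∀ τ : ℝ, 2 < τ → ∃ n₀ : ℕ, ∀ n : ℕ, n₀ ≤ n → ∀ (d : ℕ) (lam : Fin 3 → Nat.Partition d),
        isotypicSum₁ (lam 0) (isotypicSum₂ (lam 1) (isotypicSum₃ (lam 2)
          (kroneckerPow (matMulTensor ℂ n n n) d))) ≠ 0 →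
        isotypicSum₁ (lam 0) (isotypicSum₂ (lam 1) (isotypicSum₃ (lam 2)
          (kroneckerPow (unitTensor ℂ (max (n * n) ⌈(n : ℝ) ^ τ⌉₊)) d))) ≠ 0 := by
  rw [noOccurrenceObstruction_iff_semigroup_containment]
  refine ⟨fun hP τ hτ => ?_, fun hS τ hτ => ?_⟩
  · obtain ⟨n₀, hn₀⟩ := hP τ hτ
    refine ⟨n₀, fun n hn d lam hocc => hn₀ n _ hn (le_max_left _ _) ?_ d lam hocc⟩
    exact (Nat.le_ceil _).trans (by exact_mod_cast le_max_right (n * n) ⌈(n : ℝ) ^ τ⌉₊)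
  · obtain ⟨n₀, hn₀⟩ := hS τ hτ
    refine ⟨n₀, fun n m hn hnm hτm d lam hocc => ?_⟩
    have hle : max (n * n) ⌈(n : ℝ) ^ τ⌉₊ ≤ m := max_le hnm (Nat.ceil_le.2 hτm)
    exact isotypicSum_kroneckerPow_unitTensor_mono hle lam (hn₀ n hn d lam hocc)

/-- **`P_O` at one format per `n` (calculus language).**  `NoOccurrenceObstruction ⟺ ∀ τ > 2, ∃ n₀, ∀ n ≥ n₀`, every type
vanishing on the orbit of `⟨m₀⟩` vanishes on the orbit of `pad_{m₀}⟨n,n,n⟩`, for the single format `m₀ = max(n², ⌈n^τ⌉)`.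
[cite: BurgisserIkenmeyer2011, §3.1, §5] -/
theorem noOccurrenceObstruction_iff_minFormat :
    NoOccurrenceObstruction ↔
      ∀ τ : ℝ, 2 < τ → ∃ n₀ : ℕ, ∀ n : ℕ, n₀ ≤ n → ∀ (Λ : Fin 3 → Fin (max (n * n) ⌈(n : ℝ) ^ τ⌉₊) → ℕ) (d : ℕ),
        hwvSpace Λ d ≤ orbitVanishing (unitTensor ℂ (max (n * n) ⌈(n : ℝ) ^ τ⌉₊)) →
        hwvSpace Λ d ≤ orbitVanishing (padMM ℂ n (max (n * n) ⌈(n : ℝ) ^ τ⌉₊) (le_max_left _ _)) := by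
  rw [noOccurrenceObstruction_iff_minFormat_semigroup]
  refine forall_congr' fun τ => forall_congr' fun _ => exists_congr fun n₀ => forall_congr' fun n =>
    forall_congr' fun _ => ?_
  exact (hwvSpace_le_imp_iff_semigroup_containment n _ (le_max_left _ _)).symm

end Summit.MatrixMultiplication.MatrixMultiplication.Theorems.ObstructionCalculus

end
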